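import Summits.CriticalPhenomena.PercolationContinuityZ3.Theorems.PercNearOneGluingNoHeavyQuantCatHullSmallGates
import HarnessLib

/-!
# QUANT lane R8, T-DEC: THE LIGHT GLUED PAIR BY FIVE UNGATED BLOB FORESTS — a closed-form certificate for `T = (R¹[q](R^c[s]))²`
# on the explicit region `R_BF(c)` (small blob gate `s`, root gate up to `q → 1`; the "left strip" census-2 g76's dictionary left open)

builds on p205010 (kernel theorem, internal audit signed; external expert review pending)

Support file (`--supports stmt-CriticalPhenomena-4575`), QUANT lane census seat prim-quant-census-2 (gen 77), rung R8 of
`run/shared/lean/prim/quant/LADDER.md`.  Theorems only (no definition, no conjecture); standard axioms, no sorries.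

WHAT.  Census-2 g77's exact LP over a generated dictionary of gated caterpillar columns (support in `supp T`, depth ≤ 2, ≤ 3 blobs; memo
`run/shared/lean/prim/quant/prim-quant-census-2-g77/CENSUS-PAIRMAP-G77.md`) finds that for `1/2 < q ≲ 0.95` away from the heavy boundary the
light glued pair `T = t ∗ t`, `t = gate_q(δ₁ ∗ blob(c,s))` (`lpT c q s`, ✓ `…QuantLightPairCatHullColumns`) is certified by ≤ 5 PURE BLOB FORESTS
with MEAN-DETERMINED gates (no caterpillar, no outer gate), the supports tiling the `(q,s)` region in ≈ 8 patterns.  This file types the pattern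
of the upper-left strip (`M` in the memo): with `T = 2q(1+cs)` (the mean) and floor `y = qs`,
  `T = w₁·[δ₁ ∗ blob(c, (T−1)/c)] + w₂·[δ₁ ∗ blob(c+1, (T−1)/(c+1))] + w₃·[δ₁ ∗ blob(2c+1, (T−1)/(2c+1))] + w₄·[δ₂ ∗ blob(c, (T−2)/c)] + w₅·blob(c+1, T/(c+1))`,
  `w₅ = (1−q)²(c+1)/(c+1−T)`, `w₄ = q²(1−s)²c/(c+2−T)`, `w₃ = q²s²(2c+1)/(T−1)`,
  `w₁ = c(1−q)[2qs(c+1−T) − (1−q)T]/((T−1)(c+1−T))`, `w₂ = (c+1)q²(1−s)[2s(c+2−T) − (1−s)(T−2)]/((T−1)(c+2−T))`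
(atoms `0`, `2`, `2c+2`, `c+1`, `c+2` are each served by one or two columns; atom `1` then balances by mass and mean).  It is a valid hull certificate
EXACTLY on `R_BF(c) = { 1 ≤ c, 1/2 < q < 1, 0 < s < 1, T < c+1, qs ≤ 2q−1, 2(1−q) ≤ cqs, (1−q)T ≤ 2qs(c+1−T), (1−s)(T−2) ≤ 2s(c+2−T) }`
(exact scan `q, s` in steps `1/100 × 1/50`, `c ∈ {1,…,20}`: 0 mismatches between this inequality list, the certificate checker and the LP; `T < c+1`
forces the floor to be light).  E.g. `c = 4`: `q = .85, s ∈ [.09, .33]`; `q = .95, s ∈ [.03, .17]`; `c = 10`: `q = .9, s ≤ .2` — the strip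
`s < 2(1−q)/(qc)`-adjacent region census-2 g76 reported uncovered (its columns `E`, `Bt`, `Z` need `2(1−q) ≤ cqs`, `qs < 2q−1` AND weights that fail there).
* `lpT_eq_bfMix` (the pointwise identity, all parameters off the poles), `InGatedCatHull.mix5`;
* **`lpT_inGatedCatHull_bf`**: on `R_BF(c)`, `InGatedCatHull (qs) (2q(1+cs)) (2c+2) (lpT c q s)`; `_below`, `sdec_lpT_bf`, **`treeBuiltCatHull_lpT_bf`**.
HONEST STATUS.  Instances on an explicit region only (one of ≈ 8 blob-forest patterns; the others are recorded as exact closed forms / maps in the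
memo, untyped); `TreeBuiltCatHullLight`, `CatPairLight`, `SiblingStep`, `FarTreeRow` remain OPEN; RATE class log\* / honest sentence of
`run/shared/lean/prim/quant/README.md` unchanged.  [this work]; `lpT`: prim-quant-census-2 g76.  Nothing here is cited as a published result.
The gluing rows served [cite: KozmaNitzan2024, Conjecture 3 (p. 15)]; product measure [cite: Grimmett1999, §1.3 p. 10].
-/

noncomputable section

open scoped BigOperators

namespace Summit.CriticalPhenomena.PercolationContinuityZ3.Theorems
namespace Quant
namespace LawDec

open Finset

/-! ### Blob-forest columns: value forms -/

/-- `blobLaw [(a, g), (n, 1)] = slice δ_n a g` (a sure `n`-block beside one `a`-blob). [this work] -/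
theorem blobLaw_pair_sure (a n : ℕ) (g : ℝ) : blobLaw [(a, g), (n, 1)] = slice (pointLaw n) a g := by
  simp only [blobLaw]
  show slice (slice (pointLaw 0) n 1) a g = slice (pointLaw n) a g
  rw [slice_pointLaw_zero_one]

/-- value form: `blobLaw [(a, g), (n, 1)] h = (1−g)·δ_n(h) + g·δ_{a+n}(h)`. [this work] -/
theorem blobLaw_pair_sure_apply (a n : ℕ) (g : ℝ) (h : ℕ) :
    blobLaw [(a, g), (n, 1)] h = (1 - g) * pointLaw n h + g * pointLaw (a + n) h := by
  rw [blobLaw_pair_sure, lp_slice_pointLaw]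

/-- value form: `blobLaw [(a, g)] h = (1−g)·δ₀(h) + g·δ_a(h)`. [this work] -/
theorem blobLaw_one_apply (a : ℕ) (g : ℝ) (h : ℕ) : blobLaw [(a, g)] h = (1 - g) * pointLaw 0 h + g * pointLaw a h := by
  simp only [blobLaw]
  show slice (pointLaw 0) a g h = _
  rw [lp_slice_pointLaw, Nat.add_zero]

/-! ### The closed-form identity -/

/-- **THE FIVE-BLOB-FOREST IDENTITY** (pointwise; `c ≠ 0`, off the poles `T ≠ 1`, `T ≠ c+1`, `T ≠ c+2`, `T = 2q(1+cs)`). [this work] -/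
theorem lpT_eq_bfMix (c : ℕ) (q s : ℝ) (hc0 : (c : ℝ) ≠ 0) (hW : 2 * q * (1 + c * s) - 1 ≠ 0) (hU : (c : ℝ) + 1 - 2 * q * (1 + c * s) ≠ 0)
    (hV : (c : ℝ) + 2 - 2 * q * (1 + c * s) ≠ 0) (h : ℕ) :
    lpT c q s h =
      (c * (1 - q) * (2 * q * s * (c + 1 - 2 * q * (1 + c * s)) - (1 - q) * (2 * q * (1 + c * s))) /
            ((2 * q * (1 + c * s) - 1) * (c + 1 - 2 * q * (1 + c * s)))) *
          blobLaw [(c, (2 * q * (1 + c * s) - 1) / c), (1, 1)] h +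
        ((c + 1) * q ^ 2 * (1 - s) * (2 * s * (c + 2 - 2 * q * (1 + c * s)) - (1 - s) * (2 * q * (1 + c * s) - 2)) /
            ((2 * q * (1 + c * s) - 1) * (c + 2 - 2 * q * (1 + c * s)))) *
          blobLaw [(c + 1, (2 * q * (1 + c * s) - 1) / (c + 1)), (1, 1)] h +
        (q ^ 2 * s ^ 2 * (2 * c + 1) / (2 * q * (1 + c * s) - 1)) *
          blobLaw [(2 * c + 1, (2 * q * (1 + c * s) - 1) / (2 * c + 1)), (1, 1)] h +
        (q ^ 2 * (1 - s) ^ 2 * c / (c + 2 - 2 * q * (1 + c * s))) * blobLaw [(c, (2 * q * (1 + c * s) - 2) / c), (2, 1)] h +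
        ((1 - q) ^ 2 * (c + 1) / (c + 1 - 2 * q * (1 + c * s))) * blobLaw [(c + 1, 2 * q * (1 + c * s) / (c + 1))] h := by
  have hc1 : (c : ℝ) + 1 ≠ 0 := by positivity
  have hc2 : (2 : ℝ) * c + 1 ≠ 0 := by positivity
  rw [lpT_apply, blobLaw_pair_sure_apply, blobLaw_pair_sure_apply, blobLaw_pair_sure_apply, blobLaw_pair_sure_apply, blobLaw_one_apply,
    show c + 1 + 1 = c + 2 by ring, show 2 * c + 1 + 1 = 2 * c + 2 by ring]
  generalize eT : 2 * q * (1 + (c : ℝ) * s) = T at hW hU hV ⊢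
  generalize eW : T - 1 = W at hW ⊢
  generalize eU : (c : ℝ) + 1 - T = U at hU ⊢
  generalize eV : (c : ℝ) + 2 - T = V at hV ⊢
  field_simp
  subst eW eU eV eT
  ring

/-! ### Five-column mixtures -/

/-- a five-term mixture of members (common floor, mean, top) is a member. [this work] -/
theorem InGatedCatHull.mix5 {y T : ℝ} {M : ℕ} {A B C D E μ : ℕ → ℝ} (a b c d e : ℝ) (ha : 0 ≤ a) (hb : 0 ≤ b) (hc : 0 ≤ c)
    (hd : 0 ≤ d) (he : 0 ≤ e) (hsum : a + b + c + d + e = 1) (hA : InGatedCatHull y T M A) (hB : InGatedCatHull y T M B)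
    (hC : InGatedCatHull y T M C) (hD : InGatedCatHull y T M D) (hE : InGatedCatHull y T M E)
    (hμ : ∀ h, μ h = a * A h + b * B h + c * C h + d * D h + e * E h) : InGatedCatHull y T M μ := by
  refine InGatedCatHull.mixture ![a, b, c, d, e] ![A, B, C, D, E] ?_ ?_ ?_ μ ?_
  · intro k
    fin_cases k <;> simpa
  · rw [Fin.sum_univ_five]
    simpa using hsum
  · intro k
    fin_cases k
    · simpa using hA
    · simpa using hB
    · simpa using hC
    · simpa using hD
    · simpa using hE
  · intro h
    rw [Fin.sum_univ_five, hμ h]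
    simp

/-- a blob forest with gates in `[y, 1]` is a hull member at floor `0 < y < 1`, its mean `blobMean l` and any top `≥ blobTop l`. [this work] -/
theorem inGatedCatHull_blobLaw (y : ℝ) (hy0 : 0 < y) (hy1 : y < 1) (l : List (ℕ × ℝ)) (hl : ∀ p ∈ l, y ≤ p.2 ∧ p.2 ≤ 1) {M : ℕ}
    (hM : blobTop l ≤ M) : InGatedCatHull y (blobMean l) M (blobLaw l) := by
  have g := inGatedCatHull_of_catBuilt (catBuilt_blobLaw y hy0 hy1 l hl)
  rw [sum_mul_blobLaw] at g
  exact g.mono_top hM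

/-! ### Membership on the region `R_BF(c)` -/

/-- **THE LIGHT GLUED PAIR IS IN THE HULL ON `R_BF(c)`** (five ungated blob forests, closed form above): for `1 ≤ c`, `1/2 < q < 1`, `0 < s < 1`
with `T := 2q(1+cs) < c + 1`, `qs ≤ 2q − 1`, `2(1−q) ≤ c·qs`, `(1−q)T ≤ 2qs(c+1−T)` and `(1−s)(T−2) ≤ 2s(c+2−T)`:
`InGatedCatHull (qs) T (2c+2) (lpT c q s)`. [this work] -/
theorem lpT_inGatedCatHull_bf (c : ℕ) (q s : ℝ) (hc : 1 ≤ c) (hq : 1 / 2 < q) (hq1 : q < 1) (hs0 : 0 < s) (hs1 : s < 1)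
    (hT : 2 * q * (1 + c * s) < c + 1) (hB : q * s ≤ 2 * q - 1) (hE : 2 * (1 - q) ≤ c * (q * s))
    (hw1 : (1 - q) * (2 * q * (1 + c * s)) ≤ 2 * q * s * (c + 1 - 2 * q * (1 + c * s)))
    (hw2 : (1 - s) * (2 * q * (1 + c * s) - 2) ≤ 2 * s * (c + 2 - 2 * q * (1 + c * s))) :
    InGatedCatHull (q * s) (2 * q * (1 + c * s)) (2 * c + 2) (lpT c q s) := by
  have hc0' : (0 : ℝ) < c := by exact_mod_cast hc
  have hc0 : (c : ℝ) ≠ 0 := hc0'.ne'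
  have hy0 : 0 < q * s := by nlinarith
  have hy1 : q * s < 1 := by nlinarith
  set T := 2 * q * (1 + c * s) with hTdef
  have hT1 : 1 < T := by
    have : 0 < 2 * q * (c * s) := by positivity
    rw [hTdef]; nlinarith
  have hU : 0 < (c : ℝ) + 1 - T := by linarith
  have hV : 0 < (c : ℝ) + 2 - T := by linarith
  have hW : 0 < T - 1 := by linarith
  -- the five columns are members at floor `qs`, mean `T`, top `2c+2`
  have m1 : InGatedCatHull (q * s) T (2 * c + 2) (blobLaw [(c, (T - 1) / c), (1, 1)]) := by
    have g := inGatedCatHull_blobLaw (q * s) hy0 hy1 [(c, (T - 1) / c), (1, 1)] (fun p hp => by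
      simp only [List.mem_cons, List.not_mem_nil, or_false] at hp
      rcases hp with rfl | rfl
      · refine ⟨?_, ?_⟩
        · rw [le_div_iff₀ hc0']; rw [hTdef]; nlinarith
        · rw [div_le_one hc0']; linarith
      · exact ⟨hy1.le, le_rfl⟩) (M := 2 * c + 2) (by simp only [blobTop]; omega)
    have e : blobMean [(c, (T - 1) / c), (1, 1)] = T := by simp only [blobMean]; push_cast; field_simp; ring
    rwa [e] at g
  have m2 : InGatedCatHull (q * s) T (2 * c + 2) (blobLaw [(c + 1, (T - 1) / (c + 1)), (1, 1)]) := by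
    have hc1 : (0 : ℝ) < c + 1 := by positivity
    have g := inGatedCatHull_blobLaw (q * s) hy0 hy1 [(c + 1, (T - 1) / (c + 1)), (1, 1)] (fun p hp => by
      simp only [List.mem_cons, List.not_mem_nil, or_false] at hp
      rcases hp with rfl | rfl
      · refine ⟨?_, ?_⟩
        · show q * s ≤ (T - 1) / (c + 1)
          rw [le_div_iff₀ hc1, hTdef]
          have : 0 ≤ (c - 1 : ℝ) * (q * s) := mul_nonneg (by linarith [show (1 : ℝ) ≤ c by exact_mod_cast hc]) hy0.le
          nlinarith
        · show (T - 1) / (c + 1) ≤ 1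
          rw [div_le_one hc1]; linarith
      · exact ⟨hy1.le, le_rfl⟩) (M := 2 * c + 2) (by simp only [blobTop]; omega)
    have e : blobMean [(c + 1, (T - 1) / (c + 1)), (1, 1)] = T := by
      simp only [blobMean]; push_cast; field_simp; ring
    rwa [e] at g
  have m3 : InGatedCatHull (q * s) T (2 * c + 2) (blobLaw [(2 * c + 1, (T - 1) / (2 * c + 1)), (1, 1)]) := by
    have hc2 : (0 : ℝ) < 2 * c + 1 := by positivity
    have g := inGatedCatHull_blobLaw (q * s) hy0 hy1 [(2 * c + 1, (T - 1) / (2 * c + 1)), (1, 1)] (fun p hp => by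
      simp only [List.mem_cons, List.not_mem_nil, or_false] at hp
      rcases hp with rfl | rfl
      · refine ⟨?_, ?_⟩
        · show q * s ≤ (T - 1) / (2 * c + 1)
          rw [le_div_iff₀ hc2, hTdef]; nlinarith
        · show (T - 1) / (2 * c + 1) ≤ 1
          rw [div_le_one hc2]; linarith
      · exact ⟨hy1.le, le_rfl⟩) (M := 2 * c + 2) (by simp only [blobTop]; omega)
    have e : blobMean [(2 * c + 1, (T - 1) / (2 * c + 1)), (1, 1)] = T := by
      simp only [blobMean]; push_cast; field_simp; ring
    rwa [e] at g
  have m4 : InGatedCatHull (q * s) T (2 * c + 2) (blobLaw [(c, (T - 2) / c), (2, 1)]) := by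
    have g := inGatedCatHull_blobLaw (q * s) hy0 hy1 [(c, (T - 2) / c), (2, 1)] (fun p hp => by
      simp only [List.mem_cons, List.not_mem_nil, or_false] at hp
      rcases hp with rfl | rfl
      · refine ⟨?_, ?_⟩
        · rw [le_div_iff₀ hc0']; rw [hTdef]; nlinarith
        · rw [div_le_one hc0']; linarith
      · exact ⟨hy1.le, le_rfl⟩) (M := 2 * c + 2) (by simp only [blobTop]; omega)
    have e : blobMean [(c, (T - 2) / c), (2, 1)] = T := by simp only [blobMean]; push_cast; field_simp; ring
    rwa [e] at g
  have m5 : InGatedCatHull (q * s) T (2 * c + 2) (blobLaw [(c + 1, T / (c + 1))]) := by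
    have hc1 : (0 : ℝ) < c + 1 := by positivity
    have g := inGatedCatHull_blobLaw (q * s) hy0 hy1 [(c + 1, T / (c + 1))] (fun p hp => by
      simp only [List.mem_cons, List.not_mem_nil, or_false] at hp
      subst hp
      refine ⟨?_, ?_⟩
      · show q * s ≤ T / (c + 1)
        rw [le_div_iff₀ hc1, hTdef]; nlinarith
      · show T / (c + 1) ≤ 1
        rw [div_le_one hc1]; linarith) (M := 2 * c + 2) (by simp only [blobTop]; omega)
    have e : blobMean [(c + 1, T / (c + 1))] = T := by simp only [blobMean]; push_cast; field_simp; ring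
    rwa [e] at g
  -- weights
  have hq0 : 0 < q := by linarith
  refine InGatedCatHull.mix5
    (c * (1 - q) * (2 * q * s * (c + 1 - T) - (1 - q) * T) / ((T - 1) * (c + 1 - T)))
    ((c + 1) * q ^ 2 * (1 - s) * (2 * s * (c + 2 - T) - (1 - s) * (T - 2)) / ((T - 1) * (c + 2 - T)))
    (q ^ 2 * s ^ 2 * (2 * c + 1) / (T - 1)) (q ^ 2 * (1 - s) ^ 2 * c / (c + 2 - T)) ((1 - q) ^ 2 * (c + 1) / (c + 1 - T))
    ?_ ?_ ?_ ?_ ?_ ?_ m1 m2 m3 m4 m5 fun h => ?_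
  · exact div_nonneg (mul_nonneg (mul_nonneg hc0'.le (by linarith)) (by linarith)) (mul_pos hW hU).le
  · exact div_nonneg (mul_nonneg (mul_nonneg (mul_nonneg (by positivity) (sq_nonneg q)) (by linarith)) (by linarith))
      (mul_pos hW hV).le
  · exact div_nonneg (by positivity) hW.le
  · exact div_nonneg (mul_nonneg (mul_nonneg (sq_nonneg q) (sq_nonneg _)) hc0'.le) hV.le
  · exact div_nonneg (mul_nonneg (sq_nonneg _) (by positivity)) hU.le
  · field_simp
    rw [hTdef]
    ring
  · exact lpT_eq_bfMix c q s hc0 hW.ne' hU.ne' hV.ne' h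

/-- **… hence at every floor `0 < x ≤ qs`**, with the mean written as the law's own first moment. [this work] -/
theorem lpT_inGatedCatHull_bf_below (c : ℕ) (q s : ℝ) (hc : 1 ≤ c) (hq : 1 / 2 < q) (hq1 : q < 1) (hs0 : 0 < s) (hs1 : s < 1)
    (hT : 2 * q * (1 + c * s) < c + 1) (hB : q * s ≤ 2 * q - 1) (hE : 2 * (1 - q) ≤ c * (q * s))
    (hw1 : (1 - q) * (2 * q * (1 + c * s)) ≤ 2 * q * s * (c + 1 - 2 * q * (1 + c * s)))
    (hw2 : (1 - s) * (2 * q * (1 + c * s) - 2) ≤ 2 * s * (c + 2 - 2 * q * (1 + c * s)))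
    (x : ℝ) (hx0 : 0 < x) (hx : x ≤ q * s) :
    InGatedCatHull x (∑ h ∈ Finset.range (2 * c + 2 + 1), (h : ℝ) * lpT c q s h) (2 * c + 2) (lpT c q s) := by
  rw [lpT_mean]
  exact (lpT_inGatedCatHull_bf c q s hc hq hq1 hs0 hs1 hT hB hE hw1 hw2).mono hx0 hx

/-- **SDEC at the natural floor** on `R_BF(c)`. [this work] -/
theorem sdec_lpT_bf (c : ℕ) (q s : ℝ) (hc : 1 ≤ c) (hq : 1 / 2 < q) (hq1 : q < 1) (hs0 : 0 < s) (hs1 : s < 1)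
    (hT : 2 * q * (1 + c * s) < c + 1) (hB : q * s ≤ 2 * q - 1) (hE : 2 * (1 - q) ≤ c * (q * s))
    (hw1 : (1 - q) * (2 * q * (1 + c * s)) ≤ 2 * q * s * (c + 1 - 2 * q * (1 + c * s)))
    (hw2 : (1 - s) * (2 * q * (1 + c * s) - 2) ≤ 2 * s * (c + 2 - 2 * q * (1 + c * s))) :
    SDEC (q * s) (2 * c + 2) (lpT c q s) :=
  sdec_of_inGatedCatHull (mul_pos (by linarith) hs0) (lpT_inGatedCatHull_bf c q s hc hq hq1 hs0 hs1 hT hB hE hw1 hw2)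

/-- any tree-built presentation of the pair law has a positive floor and top `≥ 2c + 2` (the law charges its top atom, `q²s² > 0`). [this work] -/
theorem lpT_treeBuilt_top (c : ℕ) (q s : ℝ) (hq0 : 0 < q) (hq1 : q ≤ 1) (hs0 : 0 < s) (hs1 : s ≤ 1) {x : ℝ} {M : ℕ}
    (hT : TreeBuilt x M (lpT c q s)) : 0 < x ∧ 2 * c + 2 ≤ M := by
  obtain ⟨hx0, _, _, hzero, _, _⟩ := treeBuilt_lawFacts hT
  refine ⟨hx0, ?_⟩
  by_contra hlt
  have h0 := hzero (2 * c + 2) (by omega)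
  rw [lpT_apply] at h0
  have e : pointLaw (2 * c + 2) (2 * c + 2) = 1 := by simp [pointLaw_apply]
  rw [e] at h0
  have hq1' : 0 ≤ 1 - q := by linarith
  have hs1' : 0 ≤ 1 - s := by linarith
  have t0 : 0 ≤ (1 - q) ^ 2 * pointLaw 0 (2 * c + 2) := mul_nonneg (sq_nonneg _) (pointLaw_nonneg' _ _)
  have t1 : 0 ≤ 2 * q * (1 - q) * (1 - s) * pointLaw 1 (2 * c + 2) :=
    mul_nonneg (mul_nonneg (mul_nonneg (by positivity) hq1') hs1') (pointLaw_nonneg' _ _)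
  have t2 : 0 ≤ q ^ 2 * (1 - s) ^ 2 * pointLaw 2 (2 * c + 2) :=
    mul_nonneg (mul_nonneg (sq_nonneg _) (sq_nonneg _)) (pointLaw_nonneg' _ _)
  have t3 : 0 ≤ 2 * q * (1 - q) * s * pointLaw (c + 1) (2 * c + 2) :=
    mul_nonneg (mul_nonneg (mul_nonneg (by positivity) hq1') hs0.le) (pointLaw_nonneg' _ _)
  have t4 : 0 ≤ 2 * q ^ 2 * s * (1 - s) * pointLaw (c + 2) (2 * c + 2) :=
    mul_nonneg (mul_nonneg (by positivity) hs1') (pointLaw_nonneg' _ _)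
  have : 0 < q ^ 2 * s ^ 2 := by positivity
  linarith

/-- **THE LIGHT NODE ON THESE LAWS**: every tree-built presentation `TreeBuilt x M T` at a floor `x ≤ qs` is in the hull at `x`, its own mean and
its own top. [this work] -/
theorem treeBuiltCatHull_lpT_bf (c : ℕ) (q s : ℝ) (hc : 1 ≤ c) (hq : 1 / 2 < q) (hq1 : q < 1) (hs0 : 0 < s) (hs1 : s < 1)
    (hT : 2 * q * (1 + c * s) < c + 1) (hB : q * s ≤ 2 * q - 1) (hE : 2 * (1 - q) ≤ c * (q * s))
    (hw1 : (1 - q) * (2 * q * (1 + c * s)) ≤ 2 * q * s * (c + 1 - 2 * q * (1 + c * s)))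
    (hw2 : (1 - s) * (2 * q * (1 + c * s) - 2) ≤ 2 * s * (c + 2 - 2 * q * (1 + c * s)))
    (x : ℝ) (M : ℕ) (hTB : TreeBuilt x M (lpT c q s)) (hx : x ≤ q * s) :
    InGatedCatHull x (∑ h ∈ Finset.range (M + 1), (h : ℝ) * lpT c q s h) M (lpT c q s) := by
  obtain ⟨hx0, hM⟩ := lpT_treeBuilt_top c q s (by linarith) hq1.le hs0 hs1.le hTB
  obtain ⟨a, rfl⟩ := Nat.exists_eq_add_of_le hM
  rw [sum_range_extend (fun h => (h : ℝ) * lpT c q s h) (2 * c + 2) a (fun h hh => by rw [lpT_eq_zero c q s h hh, mul_zero]),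
    lpT_mean]
  exact ((lpT_inGatedCatHull_bf c q s hc hq hq1 hs0 hs1 hT hB hE hw1 hw2).mono hx0 hx).mono_top hM

end LawDec
end Quant
end Summit.CriticalPhenomena.PercolationContinuityZ3.Theorems
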